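import Mathlib
import Summits.Ventures.PercRepro2.Defs
import Summits.Ventures.PercRepro2.Harris
import Summits.Ventures.PercRepro2.Graph
import Summits.Ventures.PercRepro2.WForm
import Summits.Ventures.PercRepro2.WStatus
import Summits.Ventures.PercRepro2.WBern
import Summits.Ventures.PercRepro2.TypedBases
import Summits.Ventures.PercRepro2.CompHarris
import Summits.Ventures.PercRepro2.WBernTwo

/-!
# The W-inequality for two test vertices without avoided set (blind cell PercRepro2, mine-1 g14)
proofs/MINE1-WBERN.md §5, §9 ((W-OBS), Harris on the complementary model); MINE-1.md §30.

For `F = {x, y}` the W-form of the status law `W = statusW p ends s T {x, y}` has the closed form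
`Q(g, h) = 2 (W∅ Wₓ (gₓ − g∅)(hₓ − h∅) + W∅ W_y (g_y − g∅)(h_y − h∅) + W∅ W_{xy} (g_{xy} − g∅)(h_{xy} − h∅)
+ Wₓ W_y (gₓ − g_y)(hₓ − h_y))` (`Q_status_two`). On the principal pair `g = 1_{x ∈ ·}`, `h = 1_{y ∈ ·}`
it is `2 (W∅ W_{xy} − Wₓ W_y)`, and `WBernTwo.typedCoef_two_nonneg` (every typed-base coefficient of that
pair is `≥ 0`, by Harris at `p = ½` on the complementary model) gives the **two-point W-inequality**
`Wₓ W_y ≤ W∅ W_{xy}` for `T = ∅` and every admissible `p` (`statusW_two_mul_le`). Every other pair of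
up-sets of `2^{x,y}` is nested, so the layer cake `WForm.wIneq_of_upperSets` turns this single
inequality into the full monotone form: `WIneqStatus p ends s ∅ {x, y}` (`wIneqStatus_two`), hence
row 2′W for every test set with `|F| ≤ 2` and `T = ∅` (`wIneqStatus_of_card_le_two`).
-/

namespace Summit.Ventures.PercRepro2

section ClosedForm

variable {V : Type*} {E : Type*} [Fintype E] [DecidableEq E] [Fintype V] [DecidableEq V]
  {R : Type*} [CommRing R]

variable (p : E → R) (ends : E → Sym2 V) (s : V) (T : Finset V)

omit [Fintype V] in
/-- The status weight vanishes off the subsets of the test set. -/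
lemma statusW_eq_zero_of_not_subset (F S : Finset V) (h : ¬ S ⊆ F) :
    statusW p ends s T F S = 0 := by
  unfold statusW
  rw [if_neg h]

omit [DecidableEq V] in
/-- A sum over all finsets of a function supported on the subsets of `F` is a sum over `F.powerset`. -/
lemma sum_eq_sum_powerset_of_support {F : Finset V} (f : Finset V → R)
    (hf : ∀ S, ¬ S ⊆ F → f S = 0) : ∑ S, f S = ∑ S ∈ F.powerset, f S :=
  (Finset.sum_subset (Finset.subset_univ _)
    (fun S _ hS => hf S (fun h => hS (Finset.mem_powerset.mpr h)))).symm

omit [Fintype V] [DecidableEq E] [Fintype E] in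
/-- The powerset of a singleton. -/
lemma powerset_singleton' (a : V) : ({a} : Finset V).powerset = {∅, {a}} := by
  ext S
  simp [Finset.subset_singleton_iff]

/-- **Closed form of the two-point W-form**: for `F = {x, y}` the W-form of the status law is
`2 (W∅ Wₓ (gₓ − g∅)(hₓ − h∅) + W∅ W_y (g_y − g∅)(h_y − h∅) + W∅ W_{xy} (g_{xy} − g∅)(h_{xy} − h∅)
+ Wₓ W_y (gₓ − g_y)(hₓ − h_y))`. -/
theorem Q_status_two (x y : V) (hxy : x ≠ y) (g h : Finset V → R) :
    WForm.Q (fun S S' : Finset V => Disjoint S S') (statusW p ends s T {x, y}) g h =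
      2 * (statusW p ends s T {x, y} ∅ * statusW p ends s T {x, y} {x} *
            ((g {x} - g ∅) * (h {x} - h ∅))
        + statusW p ends s T {x, y} ∅ * statusW p ends s T {x, y} {y} *
            ((g {y} - g ∅) * (h {y} - h ∅))
        + statusW p ends s T {x, y} ∅ * statusW p ends s T {x, y} {x, y} *
            ((g {x, y} - g ∅) * (h {x, y} - h ∅))
        + statusW p ends s T {x, y} {x} * statusW p ends s T {x, y} {y} *
            ((g {x} - g {y}) * (h {x} - h {y}))) := by
  have hsupp : ∀ S : Finset V, ¬ S ⊆ {x, y} → statusW p ends s T {x, y} S = 0 :=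
    fun S hS => statusW_eq_zero_of_not_subset p ends s T _ S hS
  have hxy' : x ∉ ({y} : Finset V) := by simpa using hxy
  have hne : (∅ : Finset V) ≠ {y} := (Finset.singleton_ne_empty y).symm
  unfold WForm.Q WForm.S WForm.coef
  rw [sum_eq_sum_powerset_of_support (F := {x, y}) _ (fun S hS => ?_)]
  · rw [Finset.sum_congr rfl (fun S _ => sum_eq_sum_powerset_of_support (F := {x, y}) _
      (fun S' hS' => ?_))]
    · rw [show ({x, y} : Finset V) = insert x {y} from rfl]
      simp only [Finset.sum_powerset_insert hxy', powerset_singleton', Finset.sum_pair hne]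
      simp [hxy, hxy.symm]
      ring
    · rw [hsupp S' hS']
      simp
  · refine Finset.sum_eq_zero fun S' _ => ?_
    rw [hsupp S hS]
    simp

end ClosedForm

section TwoPoint

variable {V : Type*} {E : Type*} [Fintype E] [DecidableEq E] [Fintype V] [DecidableEq V]
  {R : Type*} [Field R] [LinearOrder R] [IsStrictOrderedRing R]

variable (p : E → R) (ends : E → Sym2 V) (s : V)

/-- The principal two-point W-form (`g = 1_{x ∈ ·}`, `h = 1_{y ∈ ·}`, `T = ∅`) is nonnegative for every
admissible weight vector: the typed-base expansion of `WBern.lean` with the coefficients of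
`WBernTwo.typedCoef_two_nonneg`. -/
theorem Q_status_two_principal_nonneg (hp : IsProbVec p) (x y : V) :
    0 ≤ WForm.Q (fun S S' : Finset V => Disjoint S S') (statusW p ends s ∅ {x, y})
      (fun S => if x ∈ S then (1 : R) else 0) (fun S => if y ∈ S then (1 : R) else 0) := by
  rw [Q_eq_sum_typedWeight_mul_typedCoef]
  exact Finset.sum_nonneg fun n _ =>
    mul_nonneg (typedWeight_nonneg hp n) (typedCoef_two_nonneg ends s x y n)

/-- **The two-point W-inequality** (`T = ∅`): `P(C ∩ {x,y} = {x}) · P(C ∩ {x,y} = {y}) ≤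
P(C ∩ {x,y} = ∅) · P(C ⊇ {x,y})` for every admissible `p`. -/
theorem statusW_two_mul_le (hp : IsProbVec p) (x y : V) (hxy : x ≠ y) :
    statusW p ends s ∅ {x, y} {x} * statusW p ends s ∅ {x, y} {y} ≤
      statusW p ends s ∅ {x, y} ∅ * statusW p ends s ∅ {x, y} {x, y} := by
  have h := Q_status_two_principal_nonneg p ends s hp x y
  rw [Q_status_two p ends s ∅ x y hxy] at h
  have hyx : y ≠ x := hxy.symm
  simp only [Finset.mem_singleton, Finset.mem_insert, Finset.notMem_empty, hxy, hyx,
    if_true, if_false, or_true, or_false, sub_zero, sub_self,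
    mul_zero, mul_one, one_mul, add_zero, zero_add] at h
  linarith

omit [Fintype E] [DecidableEq E] [Fintype V] in
/-- Indicators are nonnegative. -/
lemma ind_nonneg (U : Finset (Finset V)) (S : Finset V) : (0 : R) ≤ WForm.ind U S := by
  unfold WForm.ind
  split_ifs <;> norm_num

omit [Fintype E] [DecidableEq E] [Fintype V] in
/-- The indicator of an up-set is monotone along an implication of memberships. -/
lemma ind_le_ind (U : Finset (Finset V)) {S S' : Finset V} (h : S ∈ U → S' ∈ U) :
    (WForm.ind U S : R) ≤ WForm.ind U S' := by
  unfold WForm.ind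
  split_ifs with h1 h2 <;> first | exact absurd (h h1) h2 | norm_num

/-- **Row 2′W for two test vertices without avoided set**: the W-inequality of the status law of
`(G, s, ∅, {x, y})` holds for every admissible weight vector. Proof: the layer cake
(`WForm.wIneq_of_upperSets`) reduces it to pairs of up-sets `U, V`; in the closed form `Q_status_two`,
with `a = uₓ − u∅`, `b = u_y − u∅`, `c = u_{xy} − u∅`, `d = a − b` (primes for `V`), the up-set property
gives `c ± d ≥ 0`, hence `cc' + dd' ≥ 0` from `(c − d)(c' − d') + (c + d)(c' + d') = 2(cc' + dd')`, and the
form is `W∅Wₓ·aa' + W∅W_y·bb' + (W∅W_{xy} − WₓW_y)·cc' + WₓW_y·(cc' + dd') ≥ 0` by the two-point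
inequality `statusW_two_mul_le`. -/
theorem wIneqStatus_two (hp : IsProbVec p) (x y : V) (hxy : x ≠ y) :
    WIneqStatus p ends s ∅ {x, y} := by
  have hW : ∀ S, 0 ≤ statusW p ends s ∅ {x, y} S := statusW_nonneg ends s ∅ {x, y} hp
  have key := statusW_two_mul_le p ends s hp x y hxy
  have h0x := mul_nonneg (hW ∅) (hW {x})
  have h0y := mul_nonneg (hW ∅) (hW {y})
  have hxy' := mul_nonneg (hW {x}) (hW {y})
  have hkey : 0 ≤ statusW p ends s ∅ {x, y} ∅ * statusW p ends s ∅ {x, y} {x, y} -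
      statusW p ends s ∅ {x, y} {x} * statusW p ends s ∅ {x, y} {y} := sub_nonneg.mpr key
  refine WForm.wIneq_of_upperSets hW ?_
  intro U V hU hV
  rw [Q_status_two p ends s ∅ x y hxy]
  -- the four monotonicity facts of each up-set
  have hU1 : (WForm.ind U ∅ : R) ≤ WForm.ind U {x} :=
    ind_le_ind U fun h => hU (Finset.empty_subset _) h
  have hU2 : (WForm.ind U ∅ : R) ≤ WForm.ind U {y} :=
    ind_le_ind U fun h => hU (Finset.empty_subset _) h
  have hU3 : (WForm.ind U {x} : R) ≤ WForm.ind U {x, y} :=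
    ind_le_ind U fun h => hU (Finset.singleton_subset_iff.mpr (Finset.mem_insert_self x {y})) h
  have hU4 : (WForm.ind U {y} : R) ≤ WForm.ind U {x, y} :=
    ind_le_ind U fun h => hU (Finset.subset_insert x {y}) h
  have hV1 : (WForm.ind V ∅ : R) ≤ WForm.ind V {x} :=
    ind_le_ind V fun h => hV (Finset.empty_subset _) h
  have hV2 : (WForm.ind V ∅ : R) ≤ WForm.ind V {y} :=
    ind_le_ind V fun h => hV (Finset.empty_subset _) h
  have hV3 : (WForm.ind V {x} : R) ≤ WForm.ind V {x, y} :=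
    ind_le_ind V fun h => hV (Finset.singleton_subset_iff.mpr (Finset.mem_insert_self x {y})) h
  have hV4 : (WForm.ind V {y} : R) ≤ WForm.ind V {x, y} :=
    ind_le_ind V fun h => hV (Finset.subset_insert x {y}) h
  -- `c ∓ d ≥ 0` for both up-sets
  have hcm : (0 : R) ≤ (WForm.ind U {x, y} - WForm.ind U ∅) - (WForm.ind U {x} - WForm.ind U {y}) := by
    linarith
  have hcp : (0 : R) ≤ (WForm.ind U {x, y} - WForm.ind U ∅) + (WForm.ind U {x} - WForm.ind U {y}) := by
    linarith
  have hcm' : (0 : R) ≤ (WForm.ind V {x, y} - WForm.ind V ∅) - (WForm.ind V {x} - WForm.ind V {y}) := by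
    linarith
  have hcp' : (0 : R) ≤ (WForm.ind V {x, y} - WForm.ind V ∅) + (WForm.ind V {x} - WForm.ind V {y}) := by
    linarith
  -- `cc' + dd' ≥ 0`
  have hCD : (0 : R) ≤ (WForm.ind U {x, y} - WForm.ind U ∅) * (WForm.ind V {x, y} - WForm.ind V ∅) +
      (WForm.ind U {x} - WForm.ind U {y}) * (WForm.ind V {x} - WForm.ind V {y}) := by
    nlinarith [mul_nonneg hcm hcm', mul_nonneg hcp hcp']
  have hA : (0 : R) ≤ (WForm.ind U {x} - WForm.ind U ∅) * (WForm.ind V {x} - WForm.ind V ∅) :=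
    mul_nonneg (sub_nonneg.mpr hU1) (sub_nonneg.mpr hV1)
  have hB : (0 : R) ≤ (WForm.ind U {y} - WForm.ind U ∅) * (WForm.ind V {y} - WForm.ind V ∅) :=
    mul_nonneg (sub_nonneg.mpr hU2) (sub_nonneg.mpr hV2)
  have hC : (0 : R) ≤ (WForm.ind U {x, y} - WForm.ind U ∅) * (WForm.ind V {x, y} - WForm.ind V ∅) :=
    mul_nonneg (sub_nonneg.mpr (hU1.trans hU3)) (sub_nonneg.mpr (hV1.trans hV3))
  nlinarith [mul_nonneg h0x hA, mul_nonneg h0y hB, mul_nonneg hkey hC, mul_nonneg hxy' hCD]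

/-- **Row 2′W at `|F| ≤ 2`, `T = ∅`**: the W-inequality of the status law holds for every admissible
weight vector and every test set of at most two vertices (`|F| ≤ 1`: `WStatus.lean`; `|F| = 2`:
`wIneqStatus_two`). -/
theorem wIneqStatus_of_card_le_two (hp : IsProbVec p) (F : Finset V) (hF : F.card ≤ 2) :
    WIneqStatus p ends s ∅ F := by
  rcases Nat.lt_or_ge F.card 2 with h | h
  · exact wIneqStatus_of_card_le_one ends s ∅ F hp (by omega)
  · obtain ⟨x, y, hxy, rfl⟩ := Finset.card_eq_two.mp (le_antisymm hF h)
    exact wIneqStatus_two p ends s hp x y hxy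

end TwoPoint

end Summit.Ventures.PercRepro2
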